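import Summits.CriticalPhenomena.Ising3DConformalLimit.Theses.PerfectScreening
import Summits.CriticalPhenomena.Ising3DConformalLimit.Theses.PlantedPinning
import Summits.CriticalPhenomena.Ising3DConformalLimit.Theses.LeeYangGap
import Summits.CriticalPhenomena.Ising3DConformalLimit.Theses.SubPtolemyInterlacing
import Summits.CriticalPhenomena.Ising3DConformalLimit.Theses.EnergyNotSigmaSquared
import Summits.CriticalPhenomena.Ising3DConformalLimit.Theses.HyperoctahedralRP
import Summits.CriticalPhenomena.Ising3DConformalLimit.Theorems.PlantedPinningMoebiusLimitExistsLocalWardTight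
import Summits.CriticalPhenomena.Ising3DConformalLimit.Theorems.PlantedPinningMoebiusLimitExistsJetVanishing
import Literature.Probability.LatticeModels.SCTWardIdentity
import Literature.MathematicalPhysics.QuantumFieldTheory.PointwiseOSReconstruction
import HarnessLib

/-!
# The JET door for the conformal Ward identities of Ising₃ scaling limits
(crux `MoebiusLimitExists`, stmt-CriticalPhenomena-1344, line `Sketch` v16, lead prover-line-stmt-CriticalPhenomena-1344-c19-0;
THEOREM-ONLY, `--supports stmt-CriticalPhenomena-1344`)

Skeleton v15 (lead c18) left the crux as `item 1981 ∧ 7⁗_loc`: at each even level `n ≥ 4`, the weak `K_{e₀}` Ward identity of the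
limit on SOME non-empty open set of configurations (`…LocalWardTight.lean`, p157754).  This file pushes the localisation to its end:

* `jet_eq_zero_of_ward` / `localWard_of_jet` (pure analysis, one real-analytic level `F`, one generator, any weight): the weak `K_b`
  identity for all tests off the diagonals forces the TAYLOR JET of the pointwise defect
  `x ↦ DF(x)[(‖xᵢ‖²b − 2⟪b,xᵢ⟫xᵢ)ᵢ] − 2Δ'(Σᵢ⟪b,xᵢ⟫)F(x)` to vanish at every configuration (C2 p156884 + openness), and conversely a
  vanishing jet at ONE configuration gives the weak identity near it (J1 `stub_eventuallyEq_zero_of_jet` p-landed + C1 p157117);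
* for normalised non-degenerate Euclidean scale-covariant limits of `criticalCorr 3` (real-analytic on all of `NonCoincident`,
  `analyticOnNhd_limit` p157368): **7⁗ ⟺ 7⁗_jet** (`k1EvenGeFour_iff_jetK1EvenGeFour_of_limit`), **7⁗_jet ⟺ Möbius covariance**
  (`jetK1EvenGeFour_iff_isMoebiusCovariant_of_limit`), **item 1982 ⟺ the bare JET upgrade** (`inversionUpgradeNormalised_iff_jetK1WardUpgrade`),
  and the census line **crux ⟺ 1981 ∧ 7⁗_jet** (`MoebiusLimitExists_iff_existence_and_jetK1WardStrict`, route spellings).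

So the conformal content of the 3D-Ising `σ`-sector is a statement about the Taylor coefficients of ONE scalar real-analytic function
at ONE (arbitrary) non-coincident configuration per even level `n ≥ 4`.  No mechanism is claimed; the companion file
`…DefectSymmetry.lean` records which of these coefficients are protected by `O(3) × S_n` (free zeros of the defect).

References: Glimm–Jaffe 1987 §6.1 Thm 6.1.3, §19.7 [GlimmJaffe1987]; Di Francesco–Mathieu–Sénéchal 1997 §4.3.1 (4.51)–(4.56)
[FrancescoMathieuSenechal1997]; Duminil-Copin, ICM 2022 §8.4 [DuminilCopinICM2022].  No definitions, no `sorry`.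
-/

noncomputable section

namespace Summit.CriticalPhenomena.Ising3DConformalLimit.MoebiusLimitExistsJetDoor

open Filter Topology MeasureTheory Set
open Literature.Probability.LatticeModels Literature.MathematicalPhysics.QuantumFieldTheory
open Summit.CriticalPhenomena.Ising3DConformalLimit.Theses
open Summit.CriticalPhenomena.Ising3DConformalLimit.MoebiusLimitExistsSketchV13
  (stub_nonCoincident_pathConnected stub_ward_of_pointwise stub_pointwise_of_ward)
open Summit.CriticalPhenomena.Ising3DConformalLimit.MoebiusLimitExistsSketchV16 (stub_eventuallyEq_zero_of_jet)
open Summit.CriticalPhenomena.Ising3DConformalLimit.MoebiusLimitExistsLocalWard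
  (analyticOnNhd_limit analyticOnNhd_defect k1EvenGeFour_of_localK1EvenGeFour k1EvenGeFour_iff_localK1EvenGeFour_of_limit
    MoebiusLimitExists_iff_existence_and_localK1WardStrict inversionUpgradeNormalised_iff_localK1WardUpgrade
    localK1EvenGeFour_iff_isMoebiusCovariant_of_limit)

/-! ## J. Pure analysis: the weak `K_b` identity of a real-analytic level ⟺ a vanishing jet of its defect -/

/-- **The jet of a function vanishing on a neighbourhood vanishes**: if `D = 0` near `x₀` then every iterated Fréchet derivative of `D`
at `x₀` is `0`. [folklore] -/
theorem iteratedFDeriv_eq_zero_of_eventuallyEq_zero {n : ℕ} {D : (Fin n → EuclideanSpace ℝ (Fin 3)) → ℝ}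
    {x₀ : Fin n → EuclideanSpace ℝ (Fin 3)} (hD : D =ᶠ[𝓝 x₀] 0) (k : ℕ) : iteratedFDeriv ℝ k D x₀ = 0 := by
  have h := (hD.iteratedFDeriv ℝ k).eq_of_nhds
  rw [h]
  exact congrFun iteratedFDeriv_fun_zero x₀

/-- **Weak `K_b` identity ⇒ vanishing jet of the defect at every configuration of the open set.**  For a real-analytic level `F` on an
open set `U`, the weak `K_b` identity with weight `Δ'` for all tests supported in `U` gives the pointwise identity on `U` (C2), so the
defect vanishes identically on the open set `U` and all its iterated derivatives vanish at every `x₀ ∈ U`. [cite: GlimmJaffe1987, §6.1 Thm 6.1.3] -/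
theorem jet_eq_zero_of_ward {n : ℕ} {F : (Fin n → EuclideanSpace ℝ (Fin 3)) → ℝ} {U : Set (Fin n → EuclideanSpace ℝ (Fin 3))}
    (hU : IsOpen U) (hF : AnalyticOnNhd ℝ F U) (Δ' : ℝ) (b : EuclideanSpace ℝ (Fin 3))
    (hW : ∀ (φ : (Fin n → EuclideanSpace ℝ (Fin 3)) → ℝ), ContDiff ℝ ((⊤ : ℕ∞) : WithTop ℕ∞) φ → HasCompactSupport φ →
      tsupport φ ⊆ U →
      ∫ x, F x * ((2 * Δ' - 6) * (∑ i, inner ℝ b (x i)) * φ x +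
        fderiv ℝ φ x (fun i => ‖x i‖ ^ 2 • b - (2 * inner ℝ b (x i)) • x i)) = 0)
    {x₀ : Fin n → EuclideanSpace ℝ (Fin 3)} (hx₀ : x₀ ∈ U) (k : ℕ) :
    iteratedFDeriv ℝ k (fun x : Fin n → EuclideanSpace ℝ (Fin 3) =>
      fderiv ℝ F x (fun i => ‖x i‖ ^ 2 • b - (2 * inner ℝ b (x i)) • x i) - 2 * Δ' * (∑ i, inner ℝ b (x i)) * F x) x₀ = 0 := by
  have hpt := stub_pointwise_of_ward n F Δ' b U hU hF hW
  refine iteratedFDeriv_eq_zero_of_eventuallyEq_zero ?_ k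
  filter_upwards [hU.mem_nhds hx₀] with x hx
  simp only [Pi.zero_apply, sub_eq_zero]
  exact hpt x hx

/-- **Vanishing jet of the defect at ONE configuration ⇒ the local weak `K_b` identity** (one real-analytic level, one generator, any
weight): the defect is real-analytic (`analyticOnNhd_defect`), vanishes near `x₀` by J1 (`stub_eventuallyEq_zero_of_jet`), so the
pointwise identity holds on an open neighbourhood `V ⊆ NonCoincident` of `x₀` and integrates to the weak identity for tests supported in
`V` (C1). [cite: GlimmJaffe1987, §6.1 Thm 6.1.3] -/
theorem localWard_of_jet {n : ℕ} {F : (Fin n → EuclideanSpace ℝ (Fin 3)) → ℝ} (hF : AnalyticOnNhd ℝ F (NonCoincident 3 n))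
    (Δ' : ℝ) (b : EuclideanSpace ℝ (Fin 3)) {x₀ : Fin n → EuclideanSpace ℝ (Fin 3)} (hx₀ : x₀ ∈ NonCoincident 3 n)
    (hjet : ∀ k : ℕ, iteratedFDeriv ℝ k (fun x : Fin n → EuclideanSpace ℝ (Fin 3) =>
      fderiv ℝ F x (fun i => ‖x i‖ ^ 2 • b - (2 * inner ℝ b (x i)) • x i) - 2 * Δ' * (∑ i, inner ℝ b (x i)) * F x) x₀ = 0) :
    ∃ V : Set (Fin n → EuclideanSpace ℝ (Fin 3)), IsOpen V ∧ V.Nonempty ∧ V ⊆ NonCoincident 3 n ∧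
      ∀ (φ : (Fin n → EuclideanSpace ℝ (Fin 3)) → ℝ),
        ContDiff ℝ ((⊤ : ℕ∞) : WithTop ℕ∞) φ → HasCompactSupport φ → tsupport φ ⊆ V →
        ∫ x, F x * ((2 * Δ' - 6) * (∑ i, inner ℝ b (x i)) * φ x +
          fderiv ℝ φ x (fun i => ‖x i‖ ^ 2 • b - (2 * inner ℝ b (x i)) • x i)) = 0 := by
  set D : (Fin n → EuclideanSpace ℝ (Fin 3)) → ℝ := fun x =>
    fderiv ℝ F x (fun i => ‖x i‖ ^ 2 • b - (2 * inner ℝ b (x i)) • x i) - 2 * Δ' * (∑ i, inner ℝ b (x i)) * F x with hD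
  have hDan : AnalyticOnNhd ℝ D (NonCoincident 3 n) := analyticOnNhd_defect hF Δ' b
  have hD0 : D =ᶠ[𝓝 x₀] 0 := stub_eventuallyEq_zero_of_jet n D x₀ (hDan x₀ hx₀) hjet
  have hboth : ∀ᶠ x in 𝓝 x₀, D x = (0 : (Fin n → EuclideanSpace ℝ (Fin 3)) → ℝ) x ∧ x ∈ NonCoincident 3 n :=
    hD0.and ((isOpen_nonCoincident 3 n).mem_nhds hx₀)
  obtain ⟨V, hVsub, hV, hxV⟩ := _root_.eventually_nhds_iff.1 hboth
  refine ⟨V, hV, ⟨x₀, hxV⟩, fun x hx => (hVsub x hx).2, ?_⟩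
  refine stub_ward_of_pointwise n F Δ' b V hV (hF.mono fun x hx => (hVsub x hx).2) ?_
  intro x hx
  have h := (hVsub x hx).1
  simp only [hD, Pi.zero_apply, sub_eq_zero] at h
  exact h

/-! ## For Ising₃ limits: 7⁗ ⟺ 7⁗_jet, and both ⟺ Möbius covariance -/

/-- **GLOBAL from a JET** for the single generator `K_{e₀}` at the even levels `≥ 4`: for a normalised non-degenerate Euclidean
scale-covariant limit of `criticalCorr 3` (real-analytic on all of `NonCoincident`), a vanishing jet of the `K_{e₀}` defect at one
configuration per even level `≥ 4` gives the weak `K_{e₀}` identities for all tests off the diagonals (jet ⇒ local ⇒ global).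
[cite: GlimmJaffe1987, §6.1 Thm 6.1.3] -/
theorem k1EvenGeFour_of_jetK1EvenGeFour {ρ : ℝ → ℝ} {Δ : ℝ} {S : CorrFamily 3}
    (hρ : ∀ δ ∈ Set.Ioc (0:ℝ) 1, 0 < ρ δ) (hlim : HasPointwiseScalingLimit (criticalCorr 3) ρ S)
    (hnorm : ∀ n z, z ∉ NonCoincident 3 n → S n z = 0) (hnd : IsNondegenerateTwoPoint S)
    (heuc : IsEuclideanInvariant S) (hsc : IsScaleCovariant Δ S)
    (hjet : ∀ n, 4 ≤ n → Even n → ∃ x₀ ∈ NonCoincident 3 n, ∀ k : ℕ,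
        iteratedFDeriv ℝ k (fun x : Fin n → EuclideanSpace ℝ (Fin 3) =>
          fderiv ℝ (S n) x (fun i => ‖x i‖ ^ 2 • (EuclideanSpace.single 0 1 : EuclideanSpace ℝ (Fin 3)) -
            (2 * inner ℝ (EuclideanSpace.single 0 1 : EuclideanSpace ℝ (Fin 3)) (x i)) • x i) -
          2 * Δ * (∑ i, inner ℝ (EuclideanSpace.single 0 1 : EuclideanSpace ℝ (Fin 3)) (x i)) * S n x) x₀ = 0) :
    ∀ n, 4 ≤ n → Even n → ∀ (φ : (Fin n → EuclideanSpace ℝ (Fin 3)) → ℝ),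
        ContDiff ℝ ((⊤ : ℕ∞) : WithTop ℕ∞) φ → HasCompactSupport φ → tsupport φ ⊆ NonCoincident 3 n →
        ∫ x, S n x * ((2 * Δ - 6) * (∑ i, inner ℝ (EuclideanSpace.single 0 1 : EuclideanSpace ℝ (Fin 3)) (x i)) * φ x +
          fderiv ℝ φ x (fun i => ‖x i‖ ^ 2 • (EuclideanSpace.single 0 1 : EuclideanSpace ℝ (Fin 3)) -
            (2 * inner ℝ (EuclideanSpace.single 0 1 : EuclideanSpace ℝ (Fin 3)) (x i)) • x i)) = 0 := by
  refine k1EvenGeFour_of_localK1EvenGeFour hρ hlim hnorm hnd heuc hsc fun n hn4 he => ?_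
  obtain ⟨x₀, hx₀, hj⟩ := hjet n hn4 he
  exact localWard_of_jet (analyticOnNhd_limit hρ hlim hnorm hnd heuc hsc n) Δ (EuclideanSpace.single 0 1) hx₀ hj

/-- **JET from GLOBAL** (the configuration space is non-empty; C2 and openness of `NonCoincident`). [folklore] -/
theorem jetK1EvenGeFour_of_k1EvenGeFour {ρ : ℝ → ℝ} {Δ : ℝ} {S : CorrFamily 3}
    (hρ : ∀ δ ∈ Set.Ioc (0:ℝ) 1, 0 < ρ δ) (hlim : HasPointwiseScalingLimit (criticalCorr 3) ρ S)
    (hnorm : ∀ n z, z ∉ NonCoincident 3 n → S n z = 0) (hnd : IsNondegenerateTwoPoint S)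
    (heuc : IsEuclideanInvariant S) (hsc : IsScaleCovariant Δ S)
    (hK1 : ∀ n, 4 ≤ n → Even n → ∀ (φ : (Fin n → EuclideanSpace ℝ (Fin 3)) → ℝ),
        ContDiff ℝ ((⊤ : ℕ∞) : WithTop ℕ∞) φ → HasCompactSupport φ → tsupport φ ⊆ NonCoincident 3 n →
        ∫ x, S n x * ((2 * Δ - 6) * (∑ i, inner ℝ (EuclideanSpace.single 0 1 : EuclideanSpace ℝ (Fin 3)) (x i)) * φ x +
          fderiv ℝ φ x (fun i => ‖x i‖ ^ 2 • (EuclideanSpace.single 0 1 : EuclideanSpace ℝ (Fin 3)) -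
            (2 * inner ℝ (EuclideanSpace.single 0 1 : EuclideanSpace ℝ (Fin 3)) (x i)) • x i)) = 0) :
    ∀ n, 4 ≤ n → Even n → ∃ x₀ ∈ NonCoincident 3 n, ∀ k : ℕ,
        iteratedFDeriv ℝ k (fun x : Fin n → EuclideanSpace ℝ (Fin 3) =>
          fderiv ℝ (S n) x (fun i => ‖x i‖ ^ 2 • (EuclideanSpace.single 0 1 : EuclideanSpace ℝ (Fin 3)) -
            (2 * inner ℝ (EuclideanSpace.single 0 1 : EuclideanSpace ℝ (Fin 3)) (x i)) • x i) -
          2 * Δ * (∑ i, inner ℝ (EuclideanSpace.single 0 1 : EuclideanSpace ℝ (Fin 3)) (x i)) * S n x) x₀ = 0 := by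
  intro n hn4 he
  obtain ⟨x₀, hx₀⟩ := (stub_nonCoincident_pathConnected n).nonempty
  exact ⟨x₀, hx₀, jet_eq_zero_of_ward (isOpen_nonCoincident 3 n) (analyticOnNhd_limit hρ hlim hnorm hnd heuc hsc n) Δ
    (EuclideanSpace.single 0 1) (hK1 n hn4 he) hx₀⟩

/-- **The jet at EVERY configuration vanishes as soon as it vanishes at one** (for these limits; the content is configuration-free).
[cite: GlimmJaffe1987, §6.1 Thm 6.1.3] -/
theorem jetK1_everywhere_of_jetK1EvenGeFour {ρ : ℝ → ℝ} {Δ : ℝ} {S : CorrFamily 3}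
    (hρ : ∀ δ ∈ Set.Ioc (0:ℝ) 1, 0 < ρ δ) (hlim : HasPointwiseScalingLimit (criticalCorr 3) ρ S)
    (hnorm : ∀ n z, z ∉ NonCoincident 3 n → S n z = 0) (hnd : IsNondegenerateTwoPoint S)
    (heuc : IsEuclideanInvariant S) (hsc : IsScaleCovariant Δ S)
    (hjet : ∀ n, 4 ≤ n → Even n → ∃ x₀ ∈ NonCoincident 3 n, ∀ k : ℕ,
        iteratedFDeriv ℝ k (fun x : Fin n → EuclideanSpace ℝ (Fin 3) =>
          fderiv ℝ (S n) x (fun i => ‖x i‖ ^ 2 • (EuclideanSpace.single 0 1 : EuclideanSpace ℝ (Fin 3)) -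
            (2 * inner ℝ (EuclideanSpace.single 0 1 : EuclideanSpace ℝ (Fin 3)) (x i)) • x i) -
          2 * Δ * (∑ i, inner ℝ (EuclideanSpace.single 0 1 : EuclideanSpace ℝ (Fin 3)) (x i)) * S n x) x₀ = 0) :
    ∀ n, 4 ≤ n → Even n → ∀ x₀ ∈ NonCoincident 3 n, ∀ k : ℕ,
        iteratedFDeriv ℝ k (fun x : Fin n → EuclideanSpace ℝ (Fin 3) =>
          fderiv ℝ (S n) x (fun i => ‖x i‖ ^ 2 • (EuclideanSpace.single 0 1 : EuclideanSpace ℝ (Fin 3)) -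
            (2 * inner ℝ (EuclideanSpace.single 0 1 : EuclideanSpace ℝ (Fin 3)) (x i)) • x i) -
          2 * Δ * (∑ i, inner ℝ (EuclideanSpace.single 0 1 : EuclideanSpace ℝ (Fin 3)) (x i)) * S n x) x₀ = 0 :=
  fun n hn4 he _ hx₀ => jet_eq_zero_of_ward (isOpen_nonCoincident 3 n) (analyticOnNhd_limit hρ hlim hnorm hnd heuc hsc n) Δ
    (EuclideanSpace.single 0 1) (k1EvenGeFour_of_jetK1EvenGeFour hρ hlim hnorm hnd heuc hsc hjet n hn4 he) hx₀

/-- **For normalised non-degenerate Euclidean scale-covariant limits of `criticalCorr 3`: 7⁗-conclusion ⟺ 7⁗_jet-conclusion.**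
[cite: GlimmJaffe1987, §6.1 Thm 6.1.3] -/
theorem k1EvenGeFour_iff_jetK1EvenGeFour_of_limit {ρ : ℝ → ℝ} {Δ : ℝ} {S : CorrFamily 3}
    (hρ : ∀ δ ∈ Set.Ioc (0:ℝ) 1, 0 < ρ δ) (hlim : HasPointwiseScalingLimit (criticalCorr 3) ρ S)
    (hnorm : ∀ n z, z ∉ NonCoincident 3 n → S n z = 0) (hnd : IsNondegenerateTwoPoint S)
    (heuc : IsEuclideanInvariant S) (hsc : IsScaleCovariant Δ S) :
    (∀ n, 4 ≤ n → Even n → ∀ (φ : (Fin n → EuclideanSpace ℝ (Fin 3)) → ℝ),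
        ContDiff ℝ ((⊤ : ℕ∞) : WithTop ℕ∞) φ → HasCompactSupport φ → tsupport φ ⊆ NonCoincident 3 n →
        ∫ x, S n x * ((2 * Δ - 6) * (∑ i, inner ℝ (EuclideanSpace.single 0 1 : EuclideanSpace ℝ (Fin 3)) (x i)) * φ x +
          fderiv ℝ φ x (fun i => ‖x i‖ ^ 2 • (EuclideanSpace.single 0 1 : EuclideanSpace ℝ (Fin 3)) -
            (2 * inner ℝ (EuclideanSpace.single 0 1 : EuclideanSpace ℝ (Fin 3)) (x i)) • x i)) = 0) ↔
    (∀ n, 4 ≤ n → Even n → ∃ x₀ ∈ NonCoincident 3 n, ∀ k : ℕ,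
        iteratedFDeriv ℝ k (fun x : Fin n → EuclideanSpace ℝ (Fin 3) =>
          fderiv ℝ (S n) x (fun i => ‖x i‖ ^ 2 • (EuclideanSpace.single 0 1 : EuclideanSpace ℝ (Fin 3)) -
            (2 * inner ℝ (EuclideanSpace.single 0 1 : EuclideanSpace ℝ (Fin 3)) (x i)) • x i) -
          2 * Δ * (∑ i, inner ℝ (EuclideanSpace.single 0 1 : EuclideanSpace ℝ (Fin 3)) (x i)) * S n x) x₀ = 0) :=
  ⟨jetK1EvenGeFour_of_k1EvenGeFour hρ hlim hnorm hnd heuc hsc, k1EvenGeFour_of_jetK1EvenGeFour hρ hlim hnorm hnd heuc hsc⟩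

/-- **A vanishing jet of the `K_{e₀}` defect at one configuration per even level `≥ 4` IS Möbius covariance**, for normalised
non-degenerate Euclidean scale-covariant limits of `criticalCorr 3`. [cite: FrancescoMathieuSenechal1997, §4.3.1 (4.51)–(4.56)] -/
theorem jetK1EvenGeFour_iff_isMoebiusCovariant_of_limit {ρ : ℝ → ℝ} {Δ : ℝ} {S : CorrFamily 3}
    (hρ : ∀ δ ∈ Set.Ioc (0:ℝ) 1, 0 < ρ δ) (hlim : HasPointwiseScalingLimit (criticalCorr 3) ρ S)
    (hnorm : ∀ n z, z ∉ NonCoincident 3 n → S n z = 0) (hnd : IsNondegenerateTwoPoint S)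
    (heuc : IsEuclideanInvariant S) (hsc : IsScaleCovariant Δ S) :
    (∀ n, 4 ≤ n → Even n → ∃ x₀ ∈ NonCoincident 3 n, ∀ k : ℕ,
        iteratedFDeriv ℝ k (fun x : Fin n → EuclideanSpace ℝ (Fin 3) =>
          fderiv ℝ (S n) x (fun i => ‖x i‖ ^ 2 • (EuclideanSpace.single 0 1 : EuclideanSpace ℝ (Fin 3)) -
            (2 * inner ℝ (EuclideanSpace.single 0 1 : EuclideanSpace ℝ (Fin 3)) (x i)) • x i) -
          2 * Δ * (∑ i, inner ℝ (EuclideanSpace.single 0 1 : EuclideanSpace ℝ (Fin 3)) (x i)) * S n x) x₀ = 0) ↔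
      IsMoebiusCovariant Δ S := by
  rw [← k1EvenGeFour_iff_jetK1EvenGeFour_of_limit hρ hlim hnorm hnd heuc hsc,
    k1EvenGeFour_iff_localK1EvenGeFour_of_limit hρ hlim hnorm hnd heuc hsc]
  exact localK1EvenGeFour_iff_isMoebiusCovariant_of_limit hρ hlim hnorm hnd heuc hsc

/-! ## Item 1982 ⟺ the bare JET upgrade (registered anchor) -/

/-- **Item 1982 ⟺ the bare jet upgrade**: every normalised non-degenerate Euclidean scale-covariant pointwise limit of the critical `ℤ³`
correlators is inversion covariant iff for every such limit and every even `n ≥ 4` the Taylor jet of the `K_{e₀}` defect of `S n`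
vanishes at SOME non-coincident configuration. [cite: FrancescoMathieuSenechal1997, §4.3.1 eq. (4.62)] -/
theorem inversionUpgradeNormalised_iff_jetK1WardUpgrade : Summit.CriticalPhenomena.Ising3DConformalLimit.Theses.HyperoctahedralRP.InversionUpgradeNormalised ↔ (∀ (ρ : ℝ → ℝ) (Δ : ℝ) (S : Literature.Probability.LatticeModels.CorrFamily 3), (∀ δ ∈ Set.Ioc (0:ℝ) 1, 0 < ρ δ) → Literature.Probability.LatticeModels.HasPointwiseScalingLimit (Literature.Probability.LatticeModels.criticalCorr 3) ρ S → (∀ n z, z ∉ Literature.Probability.LatticeModels.NonCoincident 3 n → S n z = 0) → Literature.Probability.LatticeModels.IsNondegenerateTwoPoint S → Literature.Probability.LatticeModels.IsEuclideanInvariant S → Literature.Probability.LatticeModels.IsScaleCovariant Δ S → ∀ n, 4 ≤ n → Even n → ∃ x₀ ∈ Literature.Probability.LatticeModels.NonCoincident 3 n, ∀ k : ℕ, iteratedFDeriv ℝ k (fun x : Fin n → EuclideanSpace ℝ (Fin 3) => fderiv ℝ (S n) x (fun i => ‖x i‖ ^ 2 • (EuclideanSpace.single 0 1 : EuclideanSpace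 ℝ (Fin 3)) - (2 * inner ℝ (EuclideanSpace.single 0 1 : EuclideanSpace ℝ (Fin 3)) (x i)) • x i) - 2 * Δ * (∑ i, inner ℝ (EuclideanSpace.single 0 1 : EuclideanSpace ℝ (Fin 3)) (x i)) * S n x) x₀ = 0) := by
  rw [inversionUpgradeNormalised_iff_localK1WardUpgrade]
  refine forall_congr' fun ρ => forall_congr' fun Δ => forall_congr' fun S => forall_congr' fun hρ =>
    forall_congr' fun hlim => forall_congr' fun hnorm => forall_congr' fun hnd => forall_congr' fun heuc =>
    forall_congr' fun hsc => ?_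
  rw [← k1EvenGeFour_iff_localK1EvenGeFour_of_limit hρ hlim hnorm hnd heuc hsc]
  exact k1EvenGeFour_iff_jetK1EvenGeFour_of_limit hρ hlim hnorm hnd heuc hsc

/-! ## The crux ⟺ item 1981 ∧ 7⁗_jet (the registered residual of skeleton v16) -/

/-- **TIGHTNESS of skeleton v16: `MoebiusLimitExists ⟺ ExistsScaleCovariantLimit (1981) ∧ 7⁗_jet`** — the reshape 7⁗_loc → 7⁗_jet
drops no content and the jet residual is necessary. [cite: DuminilCopinICM2022, §8.4] -/
theorem MoebiusLimitExists_iff_existence_and_jetK1WardStrict :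
    PerfectScreening.MoebiusLimitExists ↔
      HyperoctahedralRP.ExistsScaleCovariantLimit ∧
      (∀ (ρ : ℝ → ℝ) (Δ : ℝ) (S : CorrFamily 3), (∀ δ ∈ Set.Ioc (0:ℝ) 1, 0 < ρ δ) →
        HasPointwiseScalingLimit (criticalCorr 3) ρ S → (∀ n z, z ∉ NonCoincident 3 n → S n z = 0) →
        IsNondegenerateTwoPoint S → IsEuclideanInvariant S → IsScaleCovariant Δ S →
        1 / 2 < Δ → Δ ≤ 3 / 4 → HasNontrivialU4 S →
        (∀ τ : Fin 3, PointwiseOSReconstruction τ S) →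
        (∀ (n m : ℕ) (x : Fin n → EuclideanSpace ℝ (Fin 3)) (y : Fin m → EuclideanSpace ℝ (Fin 3))
          (v : EuclideanSpace ℝ (Fin 3)), v ≠ 0 →
          Tendsto (fun t : ℝ => S (n + m) (Fin.append x (fun j => y j + t • v)) - S n x * S m y)
            atTop (𝓝 0)) →
        ∀ n, 4 ≤ n → Even n → ∃ x₀ ∈ NonCoincident 3 n, ∀ k : ℕ,
          iteratedFDeriv ℝ k (fun x : Fin n → EuclideanSpace ℝ (Fin 3) =>
            fderiv ℝ (S n) x (fun i => ‖x i‖ ^ 2 • (EuclideanSpace.single 0 1 : EuclideanSpace ℝ (Fin 3)) -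
              (2 * inner ℝ (EuclideanSpace.single 0 1 : EuclideanSpace ℝ (Fin 3)) (x i)) • x i) -
            2 * Δ * (∑ i, inner ℝ (EuclideanSpace.single 0 1 : EuclideanSpace ℝ (Fin 3)) (x i)) * S n x) x₀ = 0) := by
  rw [MoebiusLimitExists_iff_existence_and_localK1WardStrict]
  refine and_congr_right fun _ => ?_
  refine forall_congr' fun ρ => forall_congr' fun Δ => forall_congr' fun S => forall_congr' fun hρ =>
    forall_congr' fun hlim => forall_congr' fun hnorm => forall_congr' fun hnd => forall_congr' fun heuc =>
    forall_congr' fun hsc => ?_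
  refine forall_congr' fun _ => forall_congr' fun _ => forall_congr' fun _ => forall_congr' fun _ =>
    forall_congr' fun _ => ?_
  rw [← k1EvenGeFour_iff_localK1EvenGeFour_of_limit hρ hlim hnorm hnd heuc hsc]
  exact k1EvenGeFour_iff_jetK1EvenGeFour_of_limit hρ hlim hnorm hnd heuc hsc

/-- **The crux ⇐ item 1981 ∧ 7⁗_jet** (the composition of skeleton v16). [cite: DuminilCopinICM2022, §8.4] -/
theorem MoebiusLimitExists_of_existence_of_jetK1WardStrict
    (hE : HyperoctahedralRP.ExistsScaleCovariantLimit)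
    (h7 : ∀ (ρ : ℝ → ℝ) (Δ : ℝ) (S : CorrFamily 3), (∀ δ ∈ Set.Ioc (0:ℝ) 1, 0 < ρ δ) →
        HasPointwiseScalingLimit (criticalCorr 3) ρ S → (∀ n z, z ∉ NonCoincident 3 n → S n z = 0) →
        IsNondegenerateTwoPoint S → IsEuclideanInvariant S → IsScaleCovariant Δ S →
        1 / 2 < Δ → Δ ≤ 3 / 4 → HasNontrivialU4 S →
        (∀ τ : Fin 3, PointwiseOSReconstruction τ S) →
        (∀ (n m : ℕ) (x : Fin n → EuclideanSpace ℝ (Fin 3)) (y : Fin m → EuclideanSpace ℝ (Fin 3))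
          (v : EuclideanSpace ℝ (Fin 3)), v ≠ 0 →
          Tendsto (fun t : ℝ => S (n + m) (Fin.append x (fun j => y j + t • v)) - S n x * S m y)
            atTop (𝓝 0)) →
        ∀ n, 4 ≤ n → Even n → ∃ x₀ ∈ NonCoincident 3 n, ∀ k : ℕ,
          iteratedFDeriv ℝ k (fun x : Fin n → EuclideanSpace ℝ (Fin 3) =>
            fderiv ℝ (S n) x (fun i => ‖x i‖ ^ 2 • (EuclideanSpace.single 0 1 : EuclideanSpace ℝ (Fin 3)) -
              (2 * inner ℝ (EuclideanSpace.single 0 1 : EuclideanSpace ℝ (Fin 3)) (x i)) • x i) -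
            2 * Δ * (∑ i, inner ℝ (EuclideanSpace.single 0 1 : EuclideanSpace ℝ (Fin 3)) (x i)) * S n x) x₀ = 0) :
    PerfectScreening.MoebiusLimitExists :=
  MoebiusLimitExists_iff_existence_and_jetK1WardStrict.2 ⟨hE, h7⟩

/-- Route PlantedPinning's spelling of the sufficiency direction. [cite: DuminilCopinICM2022, §8.4] -/
theorem plantedPinning_MoebiusLimitExists_of_existence_of_jetK1WardStrict
    (hE : HyperoctahedralRP.ExistsScaleCovariantLimit)
    (h7 : ∀ (ρ : ℝ → ℝ) (Δ : ℝ) (S : CorrFamily 3), (∀ δ ∈ Set.Ioc (0:ℝ) 1, 0 < ρ δ) →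
        HasPointwiseScalingLimit (criticalCorr 3) ρ S → (∀ n z, z ∉ NonCoincident 3 n → S n z = 0) →
        IsNondegenerateTwoPoint S → IsEuclideanInvariant S → IsScaleCovariant Δ S →
        1 / 2 < Δ → Δ ≤ 3 / 4 → HasNontrivialU4 S →
        (∀ τ : Fin 3, PointwiseOSReconstruction τ S) →
        (∀ (n m : ℕ) (x : Fin n → EuclideanSpace ℝ (Fin 3)) (y : Fin m → EuclideanSpace ℝ (Fin 3))
          (v : EuclideanSpace ℝ (Fin 3)), v ≠ 0 →
          Tendsto (fun t : ℝ => S (n + m) (Fin.append x (fun j => y j + t • v)) - S n x * S m y)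
            atTop (𝓝 0)) →
        ∀ n, 4 ≤ n → Even n → ∃ x₀ ∈ NonCoincident 3 n, ∀ k : ℕ,
          iteratedFDeriv ℝ k (fun x : Fin n → EuclideanSpace ℝ (Fin 3) =>
            fderiv ℝ (S n) x (fun i => ‖x i‖ ^ 2 • (EuclideanSpace.single 0 1 : EuclideanSpace ℝ (Fin 3)) -
              (2 * inner ℝ (EuclideanSpace.single 0 1 : EuclideanSpace ℝ (Fin 3)) (x i)) • x i) -
            2 * Δ * (∑ i, inner ℝ (EuclideanSpace.single 0 1 : EuclideanSpace ℝ (Fin 3)) (x i)) * S n x) x₀ = 0) :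
    PlantedPinning.MoebiusLimitExists :=
  MoebiusLimitExists_of_existence_of_jetK1WardStrict hE h7

/-- Route LeeYangGap's spelling of the sufficiency direction. [cite: DuminilCopinICM2022, §8.4] -/
theorem leeYangGap_MoebiusLimitExists_of_existence_of_jetK1WardStrict
    (hE : HyperoctahedralRP.ExistsScaleCovariantLimit)
    (h7 : ∀ (ρ : ℝ → ℝ) (Δ : ℝ) (S : CorrFamily 3), (∀ δ ∈ Set.Ioc (0:ℝ) 1, 0 < ρ δ) →
        HasPointwiseScalingLimit (criticalCorr 3) ρ S → (∀ n z, z ∉ NonCoincident 3 n → S n z = 0) →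
        IsNondegenerateTwoPoint S → IsEuclideanInvariant S → IsScaleCovariant Δ S →
        1 / 2 < Δ → Δ ≤ 3 / 4 → HasNontrivialU4 S →
        (∀ τ : Fin 3, PointwiseOSReconstruction τ S) →
        (∀ (n m : ℕ) (x : Fin n → EuclideanSpace ℝ (Fin 3)) (y : Fin m → EuclideanSpace ℝ (Fin 3))
          (v : EuclideanSpace ℝ (Fin 3)), v ≠ 0 →
          Tendsto (fun t : ℝ => S (n + m) (Fin.append x (fun j => y j + t • v)) - S n x * S m y)
            atTop (𝓝 0)) →
        ∀ n, 4 ≤ n → Even n → ∃ x₀ ∈ NonCoincident 3 n, ∀ k : ℕ,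
          iteratedFDeriv ℝ k (fun x : Fin n → EuclideanSpace ℝ (Fin 3) =>
            fderiv ℝ (S n) x (fun i => ‖x i‖ ^ 2 • (EuclideanSpace.single 0 1 : EuclideanSpace ℝ (Fin 3)) -
              (2 * inner ℝ (EuclideanSpace.single 0 1 : EuclideanSpace ℝ (Fin 3)) (x i)) • x i) -
            2 * Δ * (∑ i, inner ℝ (EuclideanSpace.single 0 1 : EuclideanSpace ℝ (Fin 3)) (x i)) * S n x) x₀ = 0) :
    LeeYangGap.MoebiusLimitExists :=
  MoebiusLimitExists_of_existence_of_jetK1WardStrict hE h7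

/-- Route SubPtolemyInterlacing's spelling (`MoebiusLimit`) of the sufficiency direction. [cite: DuminilCopinICM2022, §8.4] -/
theorem subPtolemyInterlacing_MoebiusLimit_of_existence_of_jetK1WardStrict
    (hE : HyperoctahedralRP.ExistsScaleCovariantLimit)
    (h7 : ∀ (ρ : ℝ → ℝ) (Δ : ℝ) (S : CorrFamily 3), (∀ δ ∈ Set.Ioc (0:ℝ) 1, 0 < ρ δ) →
        HasPointwiseScalingLimit (criticalCorr 3) ρ S → (∀ n z, z ∉ NonCoincident 3 n → S n z = 0) →
        IsNondegenerateTwoPoint S → IsEuclideanInvariant S → IsScaleCovariant Δ S →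
        1 / 2 < Δ → Δ ≤ 3 / 4 → HasNontrivialU4 S →
        (∀ τ : Fin 3, PointwiseOSReconstruction τ S) →
        (∀ (n m : ℕ) (x : Fin n → EuclideanSpace ℝ (Fin 3)) (y : Fin m → EuclideanSpace ℝ (Fin 3))
          (v : EuclideanSpace ℝ (Fin 3)), v ≠ 0 →
          Tendsto (fun t : ℝ => S (n + m) (Fin.append x (fun j => y j + t • v)) - S n x * S m y)
            atTop (𝓝 0)) →
        ∀ n, 4 ≤ n → Even n → ∃ x₀ ∈ NonCoincident 3 n, ∀ k : ℕ,
          iteratedFDeriv ℝ k (fun x : Fin n → EuclideanSpace ℝ (Fin 3) =>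
            fderiv ℝ (S n) x (fun i => ‖x i‖ ^ 2 • (EuclideanSpace.single 0 1 : EuclideanSpace ℝ (Fin 3)) -
              (2 * inner ℝ (EuclideanSpace.single 0 1 : EuclideanSpace ℝ (Fin 3)) (x i)) • x i) -
            2 * Δ * (∑ i, inner ℝ (EuclideanSpace.single 0 1 : EuclideanSpace ℝ (Fin 3)) (x i)) * S n x) x₀ = 0) :
    SubPtolemyInterlacing.MoebiusLimit :=
  MoebiusLimitExists_of_existence_of_jetK1WardStrict hE h7

/-- The primary host route's spelling `EnergyNotSigmaSquared.MoebiusLimit` of the tightness equivalence. [cite: DuminilCopinICM2022, §8.4] -/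
theorem energyNotSigmaSquared_MoebiusLimit_iff_existence_and_jetK1WardStrict :
    EnergyNotSigmaSquared.MoebiusLimit ↔
      HyperoctahedralRP.ExistsScaleCovariantLimit ∧
      (∀ (ρ : ℝ → ℝ) (Δ : ℝ) (S : CorrFamily 3), (∀ δ ∈ Set.Ioc (0:ℝ) 1, 0 < ρ δ) →
        HasPointwiseScalingLimit (criticalCorr 3) ρ S → (∀ n z, z ∉ NonCoincident 3 n → S n z = 0) →
        IsNondegenerateTwoPoint S → IsEuclideanInvariant S → IsScaleCovariant Δ S →
        1 / 2 < Δ → Δ ≤ 3 / 4 → HasNontrivialU4 S →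
        (∀ τ : Fin 3, PointwiseOSReconstruction τ S) →
        (∀ (n m : ℕ) (x : Fin n → EuclideanSpace ℝ (Fin 3)) (y : Fin m → EuclideanSpace ℝ (Fin 3))
          (v : EuclideanSpace ℝ (Fin 3)), v ≠ 0 →
          Tendsto (fun t : ℝ => S (n + m) (Fin.append x (fun j => y j + t • v)) - S n x * S m y)
            atTop (𝓝 0)) →
        ∀ n, 4 ≤ n → Even n → ∃ x₀ ∈ NonCoincident 3 n, ∀ k : ℕ,
          iteratedFDeriv ℝ k (fun x : Fin n → EuclideanSpace ℝ (Fin 3) =>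
            fderiv ℝ (S n) x (fun i => ‖x i‖ ^ 2 • (EuclideanSpace.single 0 1 : EuclideanSpace ℝ (Fin 3)) -
              (2 * inner ℝ (EuclideanSpace.single 0 1 : EuclideanSpace ℝ (Fin 3)) (x i)) • x i) -
            2 * Δ * (∑ i, inner ℝ (EuclideanSpace.single 0 1 : EuclideanSpace ℝ (Fin 3)) (x i)) * S n x) x₀ = 0) :=
  MoebiusLimitExists_iff_existence_and_jetK1WardStrict

end Summit.CriticalPhenomena.Ising3DConformalLimit.MoebiusLimitExistsJetDoor

end
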